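import Literature.RepresentationTheory.FiniteGroups.VershikKerovMaxDegree
import Literature.RepresentationTheory.FiniteGroups.SymmetricGroupIsotypic
import Literature.NumberTheory.DiophantineGeometry.SymmetricGroupRepsFinrankSpechtProofs
import Literature.NumberTheory.DiophantineGeometry.PartitionTableauxProofs
import Literature.Combinatorics.Enumerative.PartitionNumberUpperBound
import HarnessLib

/-!
# The largest character degree of `𝔖ₙ`: the Vershik–Kerov lower bound, and the reduction of
# the upper bound to the hook-product estimate

Topic `Literature/RepresentationTheory/FiniteGroups`; companion ("Proofs" sibling) of
`VershikKerovMaxDegree.lean`, which vendors the named fact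
`VershikKerov1985_maxCharDegree` (Vershik–Kerov 1985, as quoted by Pak–Panova–Yeliussizov 2019,
§2.3 (2.3)–(2.4)): for every `ε > 0` and all large `n`,
`√(n!) e^{-(c₁+ε)√n} ≤ D(n) ≤ √(n!) e^{-(c₂-ε)√n}`, `D(n) = maxCharDegree 𝔖ₙ`, `c₁ = π/√6`,
`c₂ = (π-2)/π²`. This file PROVES, from the tree's representation theory of `𝔖ₙ`:

* `charDegrees_perm_eq`, `maxCharDegree_perm_eq` — **`D(n) = max_{μ ⊢ n} f^μ`**: the character
  degrees of `𝔖ₙ` are the numbers `f^μ = numStandardTableaux μ` of standard Young tableaux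
  (the irreducible complex representations of `𝔖ₙ` are the Specht modules,
  `exists_equiv_spechtRep_of_isIrreducible_holds`, of dimension `f^μ`, `finrank_spechtIdeal_holds`);
* `sum_sq_numStandardTableaux` — the **Burnside identity `∑_{μ ⊢ n} (f^μ)² = n!`**
  (Pak–Panova–Yeliussizov (2.5); from the tree's `∑_χ χ(1)² = |G|`, `sum_sq_charDegrees_holds`);
* `factorial_le_card_mul_maxCharDegree_sq` (`n! ≤ p(n) D(n)²`), `maxCharDegree_sq_le_factorial`
  (`D(n)² ≤ n!`), `maxCharDegree_perm_le_sqrt_factorial` (`D(n) ≤ √(n!)`);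
* `VershikKerov1985_maxCharDegree_lower` — **the lower half of the fact, for every `n` and with
  `ε = 0`: `√(n!) e^{-c₁√n} ≤ D(n)`** ("the lower bound follows from the Burnside identity",
  Pak–Panova–Yeliussizov 2019, §2.3: `D(n)² ≥ n!/p(n)` and `p(n) ≤ e^{π√(2n/3)} = e^{2c₁√n}`,
  Apostol Thm. 14.5 = the tree's `card_partition_le_exp'`), and the `ε`-form
  `VershikKerov1985_maxCharDegree_lower'`;
* `VershikKerov1985_maxCharDegree_upper_of_le` — the upper clause for `ε ≥ c₂` (where it only
  says `D(n) ≤ √(n!) e^{(ε - c₂)√n}`, implied by `D(n) ≤ √(n!)`);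
* `VershikKerov1985_maxCharDegree_of_prod_hookLength_bound` — **reduction of the whole fact to
  Vershik–Kerov's analytic estimate in hook-length form**: if for every `ε > 0` and all large `n`
  every `μ ⊢ n` has `∏_{c ∈ μ} h(c) ≥ √(n!) e^{(c₂-ε)√n}`, then `VershikKerov1985_maxCharDegree`
  holds (hook length formula `f^μ ∏ h(c) = n!`, `numStandardTableaux_mul_prod_hookLength_holds`).
  The hypothesis is the content of Vershik–Kerov 1985, §3 (the "remarkable" upper bound,
  Pak–Panova–Yeliussizov): `-log(dim²λ/n!) = (1/8)‖L_λ - Ω‖²_{1/2}·n + √n Σφ(h) + … ≥ 2c₂√n(1+o(1))`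
  via the hook integral and the limit shape `Ω` — NOT proved here (no limit-shape calculus in
  Mathlib or the tree); the named fact therefore stays undischarged.

## References

* A. M. Vershik, S. V. Kerov, *Asymptotic of the largest and the typical dimensions of
  irreducible representations of a symmetric group*, Funct. Anal. Appl. 19 (1985) 21–31
  (paywalled, not held). [VershikKerov1985]
* I. Pak, G. Panova, D. Yeliussizov, *On the largest Kronecker and Littlewood–Richardson
  coefficients*, J. Combin. Theory Ser. A 165 (2019), arXiv:1804.04693, §2.3 (2.3)–(2.5).
  [PakPanovaYeliussizov2019]
* T. M. Apostol, *Introduction to Analytic Number Theory* (1976), Thm. 14.5. [Apostol1976]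
* A. Aggarwal, D. Elboim, *On the maximal dimension of an irreducible representation of the
  symmetric group*, arXiv:2605.25995 (2026), Prop. 2.1 (the Vershik–Kerov expansion, Lemmas 1–4
  of [VershikKerov1985]) — read for the structure of the missing upper-bound argument.

## Mathlib and tree

Mathlib: `Representation.char_one`, `Representation.Equiv.toLinearEquiv`, `finsum_mem_range`,
`finsum_eq_sum_of_fintype`, `Fintype.card_perm`, `IsGreatest.csSup_eq`, `Finset.exists_mem_eq_sup`,
`Real.sqrt_le_sqrt`, `Real.le_sqrt`, `Real.mul_self_sqrt`. Tree: `irrChars_perm_eq`,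
`spechtCharacter_injective`, `isIrrChar_spechtCharacter` (`SymmetricGroupIsotypic.lean`);
`sum_sq_charDegrees_holds` (`IrreducibleCharacters.lean`); `exists_equiv_spechtRep_of_isIrreducible_holds`,
`isIrreducible_spechtRep_holds`, `finrank_spechtIdeal_holds`, `numStandardTableaux_mul_prod_hookLength_holds`,
`one_le_hookLength` (`Literature/NumberTheory/DiophantineGeometry/`); `card_partition_le_exp'`
(`Literature/Combinatorics/Enumerative/PartitionNumberUpperBound.lean`); `vkLowerConst`,
`vkUpperConst`, `VershikKerov1985_maxCharDegree` (`VershikKerovMaxDegree.lean`). Theorems only.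
-/

noncomputable section

open scoped BigOperators
open Module
open Literature.NumberTheory.DiophantineGeometry (spechtRep spechtIdeal spechtCharacter
  numStandardTableaux hookLength one_le_hookLength isIrreducible_spechtRep_holds
  exists_equiv_spechtRep_of_isIrreducible_holds finrank_spechtIdeal_holds
  numStandardTableaux_mul_prod_hookLength_holds)
open Literature.Combinatorics.Enumerative (card_partition_le_exp')

namespace Literature.RepresentationTheory.FiniteGroups

variable {n : ℕ}

/-! ### The character degrees of `𝔖ₙ` are the `f^μ` -/

/-- **The character degrees of `𝔖ₙ` are the numbers of standard Young tableaux**: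
`charDegrees 𝔖ₙ = {f^μ | μ ⊢ n}` (every irreducible representation is a Specht module `S^μ`,
Fulton–Harris Thm. 4.3, and `dim S^μ = f^μ`, Fulton–Harris (4.11) / Problem 4.47).
[cite: FultonHarrisGTM129, Theorem 4.3 and Problem 4.47] -/
theorem charDegrees_perm_eq (n : ℕ) :
    charDegrees (Equiv.Perm (Fin n)) =
      Set.range fun μ : Nat.Partition n => numStandardTableaux μ := by
  ext d
  constructor
  · rintro ⟨V, _, _, _, ρ, hρ, rfl⟩
    haveI := hρ
    obtain ⟨μ, ⟨e⟩⟩ := exists_equiv_spechtRep_of_isIrreducible_holds ℂ ρ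
    exact ⟨μ, by rw [e.toLinearEquiv.finrank_eq, finrank_spechtIdeal_holds ℂ μ]⟩
  · rintro ⟨μ, rfl⟩
    exact ⟨spechtIdeal ℂ μ, _, _, inferInstance, spechtRep ℂ μ, isIrreducible_spechtRep_holds μ,
      finrank_spechtIdeal_holds ℂ μ⟩

/-- **`D(n) = max_{μ ⊢ n} f^μ`**: the largest character degree of `𝔖ₙ` is the largest number
of standard Young tableaux of a shape with `n` boxes (Pak–Panova–Yeliussizov 2019, §1.1:
`D(n) := max_{λ ⊢ n} f^λ`). [cite: PakPanovaYeliussizov2019, §1.1] -/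
theorem maxCharDegree_perm_eq (n : ℕ) :
    maxCharDegree (Equiv.Perm (Fin n)) =
      Finset.univ.sup fun μ : Nat.Partition n => numStandardTableaux μ := by
  rw [maxCharDegree]
  refine IsGreatest.csSup_eq ⟨?_, ?_⟩
  · rw [charDegrees_perm_eq]
    obtain ⟨μ, -, hμ⟩ := Finset.exists_mem_eq_sup (Finset.univ : Finset (Nat.Partition n))
      Finset.univ_nonempty fun μ => numStandardTableaux μ
    exact ⟨μ, hμ.symm⟩
  · intro d hd
    rw [charDegrees_perm_eq] at hd
    obtain ⟨μ, rfl⟩ := hd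
    exact Finset.le_sup (f := fun μ : Nat.Partition n => numStandardTableaux μ) (Finset.mem_univ μ)

/-- `f^μ ≤ D(n)` for every `μ ⊢ n`. [cite: PakPanovaYeliussizov2019, §1.1] -/
theorem numStandardTableaux_le_maxCharDegree (μ : Nat.Partition n) :
    numStandardTableaux μ ≤ maxCharDegree (Equiv.Perm (Fin n)) := by
  rw [maxCharDegree_perm_eq]
  exact Finset.le_sup (f := fun μ : Nat.Partition n => numStandardTableaux μ) (Finset.mem_univ μ)

/-- `D(n) = f^μ` for some `μ ⊢ n` (the maximum is attained). [cite: PakPanovaYeliussizov2019, §1.1] -/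
theorem exists_numStandardTableaux_eq_maxCharDegree (n : ℕ) :
    ∃ μ : Nat.Partition n, numStandardTableaux μ = maxCharDegree (Equiv.Perm (Fin n)) := by
  rw [maxCharDegree_perm_eq]
  obtain ⟨μ, -, hμ⟩ := Finset.exists_mem_eq_sup (Finset.univ : Finset (Nat.Partition n))
    Finset.univ_nonempty fun μ => numStandardTableaux μ
  exact ⟨μ, hμ.symm⟩

/-! ### The Burnside identity `∑ (f^μ)² = n!` and its two consequences -/

/-- **Burnside's identity `∑_{μ ⊢ n} (f^μ)² = n!`** (Pak–Panova–Yeliussizov 2019, (2.5)), from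
`∑_{χ irreducible} χ(1)² = |𝔖ₙ| = n!` (`sum_sq_charDegrees_holds`), the irreducible characters of
`𝔖ₙ` being the `χ^μ` (`irrChars_perm_eq`, pairwise distinct) with `χ^μ(1) = dim S^μ = f^μ`.
[cite: PakPanovaYeliussizov2019, §2.3 (2.5)] -/
theorem sum_sq_numStandardTableaux (n : ℕ) :
    ∑ μ : Nat.Partition n, numStandardTableaux μ ^ 2 = n.factorial := by
  classical
  have h := sum_sq_charDegrees_holds (Equiv.Perm (Fin n))
  rw [irrChars_perm_eq, finsum_mem_range spechtCharacter_injective, finsum_eq_sum_of_fintype,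
    Nat.card_eq_fintype_card, Fintype.card_perm, Fintype.card_fin] at h
  have h1 : ∀ μ : Nat.Partition n, spechtCharacter ℂ μ 1 = (numStandardTableaux μ : ℂ) := fun μ => by
    rw [spechtCharacter, Representation.char_one, finrank_spechtIdeal_holds ℂ μ]
  simp_rw [h1] at h
  exact_mod_cast h

/-- **`n! ≤ p(n) · D(n)²`** (`n! = ∑_μ (f^μ)² ≤ #{μ ⊢ n} · (max f^μ)²`; Pak–Panova–Yeliussizov
2019, §2.3: "the lower bound follows from the Burnside identity").
[cite: PakPanovaYeliussizov2019, §2.3] -/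
theorem factorial_le_card_mul_maxCharDegree_sq (n : ℕ) :
    n.factorial ≤ Fintype.card (Nat.Partition n) * maxCharDegree (Equiv.Perm (Fin n)) ^ 2 := by
  rw [← sum_sq_numStandardTableaux n]
  calc ∑ μ : Nat.Partition n, numStandardTableaux μ ^ 2
      ≤ ∑ _μ : Nat.Partition n, maxCharDegree (Equiv.Perm (Fin n)) ^ 2 :=
        Finset.sum_le_sum fun μ _ => Nat.pow_le_pow_left (numStandardTableaux_le_maxCharDegree μ) 2
    _ = Fintype.card (Nat.Partition n) * maxCharDegree (Equiv.Perm (Fin n)) ^ 2 := by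
        rw [Finset.sum_const, Finset.card_univ, smul_eq_mul]

/-- **`D(n)² ≤ n!`** (one term of the Burnside identity). [cite: PakPanovaYeliussizov2019, §2.3] -/
theorem maxCharDegree_sq_le_factorial (n : ℕ) :
    maxCharDegree (Equiv.Perm (Fin n)) ^ 2 ≤ n.factorial := by
  obtain ⟨μ, hμ⟩ := exists_numStandardTableaux_eq_maxCharDegree n
  rw [← hμ, ← sum_sq_numStandardTableaux n]
  exact Finset.single_le_sum (f := fun ν : Nat.Partition n => numStandardTableaux ν ^ 2)
    (fun _ _ => Nat.zero_le _) (Finset.mem_univ μ)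

/-- **`D(n) ≤ √(n!)`** (the trivial upper bound). [cite: PakPanovaYeliussizov2019, §2.3] -/
theorem maxCharDegree_perm_le_sqrt_factorial (n : ℕ) :
    (maxCharDegree (Equiv.Perm (Fin n)) : ℝ) ≤ Real.sqrt (n.factorial : ℝ) := by
  refine (Real.le_sqrt (Nat.cast_nonneg _) (Nat.cast_nonneg _)).mpr ?_
  exact_mod_cast maxCharDegree_sq_le_factorial n

/-! ### The Vershik–Kerov lower bound -/

/-- **Vershik–Kerov lower bound, sharp-constant form valid for every `n`:
`√(n!) · e^{-c₁√n} ≤ D(n)`, `c₁ = π/√6`** (Vershik–Kerov 1985; Pak–Panova–Yeliussizov 2019,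
(2.3) lower half: `D(n)² ≥ n!/p(n)` by Burnside's identity, and `p(n) ≤ e^{π√(2n/3)} = e^{2c₁√n}`,
Apostol Thm. 14.5). [cite: VershikKerov1985, Thm. 1 (as quoted in Pak–Panova–Yeliussizov 2019, arXiv:1804.04693, §2.3 eq. (2.3))]
[cite: Apostol1976, §14.7 Thm. 14.5] -/
theorem VershikKerov1985_maxCharDegree_lower (n : ℕ) :
    Real.sqrt (n.factorial : ℝ) * Real.exp (-(vkLowerConst * Real.sqrt (n : ℝ))) ≤
      (maxCharDegree (Equiv.Perm (Fin n)) : ℝ) := by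
  set D : ℝ := (maxCharDegree (Equiv.Perm (Fin n)) : ℝ) with hD
  have hD0 : 0 ≤ D := Nat.cast_nonneg _
  have h1 : (n.factorial : ℝ) ≤ (Fintype.card (Nat.Partition n) : ℝ) * D ^ 2 := by
    rw [hD]
    exact_mod_cast factorial_le_card_mul_maxCharDegree_sq n
  have h2 : (Fintype.card (Nat.Partition n) : ℝ) ≤
      Real.exp (2 * vkLowerConst * Real.sqrt (n : ℝ)) := card_partition_le_exp' n
  -- `n! · e^{-2c₁√n} ≤ D²`
  have h3 : (n.factorial : ℝ) * Real.exp (-(2 * vkLowerConst * Real.sqrt (n : ℝ))) ≤ D ^ 2 := by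
    rw [Real.exp_neg, ← div_eq_mul_inv, div_le_iff₀ (Real.exp_pos _)]
    calc (n.factorial : ℝ) ≤ (Fintype.card (Nat.Partition n) : ℝ) * D ^ 2 := h1
      _ ≤ Real.exp (2 * vkLowerConst * Real.sqrt (n : ℝ)) * D ^ 2 :=
          mul_le_mul_of_nonneg_right h2 (sq_nonneg D)
      _ = D ^ 2 * Real.exp (2 * vkLowerConst * Real.sqrt (n : ℝ)) := mul_comm _ _
  -- take square roots
  have hexp : Real.exp (-(2 * vkLowerConst * Real.sqrt (n : ℝ))) =
      Real.exp (-(vkLowerConst * Real.sqrt (n : ℝ))) ^ 2 := by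
    rw [sq, ← Real.exp_add]
    congr 1
    ring
  have h4 : Real.sqrt ((n.factorial : ℝ) * Real.exp (-(2 * vkLowerConst * Real.sqrt (n : ℝ)))) ≤ D := by
    rw [← Real.sqrt_sq hD0]
    exact Real.sqrt_le_sqrt h3
  rwa [Real.sqrt_mul (Nat.cast_nonneg _), hexp, Real.sqrt_sq (Real.exp_pos _).le] at h4

/-- The lower clause of `VershikKerov1985_maxCharDegree`, for EVERY `n` and every `ε ≥ 0`:
`√(n!) · e^{-(c₁+ε)√n} ≤ D(n)`. [cite: VershikKerov1985, Thm. 1 (as quoted in Pak–Panova–Yeliussizov 2019, arXiv:1804.04693, §2.3 eq. (2.3))] -/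
theorem VershikKerov1985_maxCharDegree_lower' {ε : ℝ} (hε : 0 ≤ ε) (n : ℕ) :
    Real.sqrt (n.factorial : ℝ) * Real.exp (-((vkLowerConst + ε) * Real.sqrt (n : ℝ))) ≤
      (maxCharDegree (Equiv.Perm (Fin n)) : ℝ) := by
  refine le_trans ?_ (VershikKerov1985_maxCharDegree_lower n)
  refine mul_le_mul_of_nonneg_left (Real.exp_le_exp.mpr ?_) (Real.sqrt_nonneg _)
  nlinarith [Real.sqrt_nonneg (n : ℝ)]

/-- The upper clause of `VershikKerov1985_maxCharDegree` in the range `ε ≥ c₂`, where it is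
implied by the trivial bound `D(n) ≤ √(n!)` (the exponent `-(c₂ - ε)√n` is then `≥ 0`).
[cite: PakPanovaYeliussizov2019, §2.3] -/
theorem VershikKerov1985_maxCharDegree_upper_of_le {ε : ℝ} (hε : vkUpperConst ≤ ε) (n : ℕ) :
    (maxCharDegree (Equiv.Perm (Fin n)) : ℝ) ≤
      Real.sqrt (n.factorial : ℝ) * Real.exp (-((vkUpperConst - ε) * Real.sqrt (n : ℝ))) := by
  refine (maxCharDegree_perm_le_sqrt_factorial n).trans ?_
  refine le_mul_of_one_le_right (Real.sqrt_nonneg _) (Real.one_le_exp ?_)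
  nlinarith [Real.sqrt_nonneg (n : ℝ)]

/-! ### Reduction of the upper bound to the hook-product estimate -/

/-- **`f^μ = n!/∏ h(c)` as a real number** (hook length formula,
`numStandardTableaux_mul_prod_hookLength_holds`). [cite: FrameRobinsonThrallCJM1954, Theorem 1] -/
theorem numStandardTableaux_eq_factorial_div_prod_hookLength (μ : Nat.Partition n) :
    (numStandardTableaux μ : ℝ) =
      (n.factorial : ℝ) / ∏ c ∈ μ.youngDiagram.cells, (hookLength μ.youngDiagram c : ℝ) := by
  have hpos : 0 < ∏ c ∈ μ.youngDiagram.cells, (hookLength μ.youngDiagram c : ℝ) :=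
    Finset.prod_pos fun c hc => by exact_mod_cast one_le_hookLength hc
  rw [eq_div_iff hpos.ne']
  exact_mod_cast numStandardTableaux_mul_prod_hookLength_holds μ

/-- **Reduction of `VershikKerov1985_maxCharDegree` to Vershik–Kerov's hook-product estimate.**
If for every `ε > 0` there is `n₀` such that every shape `μ ⊢ n`, `n ≥ n₀`, satisfies
`∏_{c ∈ μ} h(c) ≥ √(n!) · e^{(c₂ - ε)√n}` — the analytic content of Vershik–Kerov 1985 (§3:
`-log(dim²λ/n!) ≥ 2c₂√n(1+o(1))` uniformly in `λ ⊢ n`, via the hook integral and the limit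
shape) — then the named fact holds: the lower half is `VershikKerov1985_maxCharDegree_lower'`,
and the upper half follows by the hook length formula `f^μ = n!/∏ h(c)` at a maximising `μ`.
This theorem does NOT discharge the fact; it isolates what remains to be formalised.
[cite: VershikKerov1985, Thm. 1 (as quoted in Pak–Panova–Yeliussizov 2019, arXiv:1804.04693, §2.3 eq. (2.3))] -/
theorem VershikKerov1985_maxCharDegree_of_prod_hookLength_bound
    (H : ∀ ε : ℝ, 0 < ε → ∃ n₀ : ℕ, ∀ n : ℕ, n₀ ≤ n → ∀ μ : Nat.Partition n,
      Real.sqrt (n.factorial : ℝ) * Real.exp ((vkUpperConst - ε) * Real.sqrt (n : ℝ)) ≤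
        ∏ c ∈ μ.youngDiagram.cells, (hookLength μ.youngDiagram c : ℝ)) :
    VershikKerov1985_maxCharDegree := by
  intro ε hε
  obtain ⟨n₀, hn₀⟩ := H ε hε
  refine ⟨n₀, fun n hn => ⟨VershikKerov1985_maxCharDegree_lower' hε.le n, ?_⟩⟩
  obtain ⟨μ, hμ⟩ := exists_numStandardTableaux_eq_maxCharDegree n
  rw [← hμ, numStandardTableaux_eq_factorial_div_prod_hookLength μ]
  set P : ℝ := ∏ c ∈ μ.youngDiagram.cells, (hookLength μ.youngDiagram c : ℝ) with hP
  have hb : Real.sqrt (n.factorial : ℝ) * Real.exp ((vkUpperConst - ε) * Real.sqrt (n : ℝ)) ≤ P :=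
    hn₀ n hn μ
  have hE : 0 < Real.exp ((vkUpperConst - ε) * Real.sqrt (n : ℝ)) := Real.exp_pos _
  have hSE : 0 < Real.sqrt (n.factorial : ℝ) * Real.exp ((vkUpperConst - ε) * Real.sqrt (n : ℝ)) :=
    mul_pos (Real.sqrt_pos.mpr (by exact_mod_cast n.factorial_pos)) hE
  -- `n!/P ≤ n!/(√(n!) e^{(c₂-ε)√n}) = √(n!) e^{-(c₂-ε)√n}`
  calc (n.factorial : ℝ) / P
      ≤ (n.factorial : ℝ) / (Real.sqrt (n.factorial : ℝ) *
          Real.exp ((vkUpperConst - ε) * Real.sqrt (n : ℝ))) :=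
        div_le_div_of_nonneg_left (Nat.cast_nonneg _) hSE hb
    _ = Real.sqrt (n.factorial : ℝ) * Real.exp (-((vkUpperConst - ε) * Real.sqrt (n : ℝ))) := by
        rw [Real.exp_neg, div_eq_iff hSE.ne', mul_mul_mul_comm, inv_mul_cancel₀ hE.ne', mul_one,
          Real.mul_self_sqrt (Nat.cast_nonneg _)]

end Literature.RepresentationTheory.FiniteGroups

end
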